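import Mathlib
import Summits.Ventures.HodgeRepro.Tier4.Line4.TailSeesawHaar
import Summits.Ventures.HodgeRepro.Tier4.Line4.AwayDomainRowNonsplit
import Summits.Ventures.HodgeRepro.Tier4.Line4.TorusFinSplitHaar
import Summits.Ventures.HodgeRepro.Tier4.Line4.TorusProductHaar
import Summits.Ventures.HodgeRepro.Tier4.Line4.AwayOrbitalDomain

/-!
# Tier4/Line4/TailSeesawDomain — C-L4-7B-ASSEMBLY at the plane of record with the product `Z(k)`-DOMAIN DRAWN INSIDE: the
(7b) display body of `TailSeesawHaar` with `DA hDA hfd hDZc` replaced by (E1)'s local clause `hns` and ZDOMAIN-EX's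
cocompactness `hZc`, (S-FIN-NV)'s display `haway` asked at EVERY `centreAway`-fundamental domain

Blind re-derivation cell `pub-hodge-repro`, Tier 4 «prove the step» (README §9–§10), seat t4-L2-p2 (gen 6; the `_domain`
layer announced S16189 / S16216).  Tree path `lean/Summits/Ventures/HodgeRepro/Tier4/Line4/TailSeesawDomain.lean`.  Imports
this seat's `Line4/TailSeesawHaar` (`tailForArch_seesaw_of_ratio_compact`) and `Line4/AwayDomainRowNonsplit`
(`exists_isFundamentalDomain_prod_univ_withTransportedTorus_of_nonsplit`), L2-p1's `Line4/TorusFinSplitHaar`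
(`exists_smul_map_prod_eq_fin`, `locallyCompact_torusFinAt`), `Line4/TorusProductHaar` (`locallyCompact_torusFin`) and this
seat's `Line4/AwayOrbitalDomain` (`awayOrbital_ne_zero_forall_of_ne_zero`).  Mathlib-level; no literature; no `def`.

**`tailForArch_seesaw_of_ratio_domain`**: `tailForArch_seesaw_of_ratio_compact` with the five binders `νf [IsHaar]` and
`DA hDA hfd hDZc` DELETED (`νf := Measure.haar` on `T_f`: nothing in the statement names it once the domain is drawn), the two binders `hns : ∀ v ∈ placesAbove p, ¬ IsSquare (t² − 4n)_v` ((E1)'s local clause) and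
`hZc : ∃ E compact, E ⊆ Z_f ⊆ Z(k) · E` (ZDOMAIN-EX's cocompactness — the print `Z(k)\Z(𝔸)` compact, CentreCocompact)
ADDED after `hγ₀`, and the display `haway` RESTATED at every `centreAway`-fundamental domain:
`∀ DA, MeasurableSet DA → IsFundamentalDomain (centreAway W′ (placesAbove p)) DA νA → awayOrbital W′ (placesAbove p) R γ₀ νA νA' DA ≠ 0`
(equivalent to the one-domain `haway` of the previous layers by AwayOrbitalDomain's `awayOrbital_eq_of_isFundamentalDomain`;
the twin `tailForArch_seesaw_of_ratio_domain'` below keeps the one-domain text `DA₀ hfd₀ haway`; the wrapper chooses).  The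
domain is DRAWN from AwayDomainRowNonsplit with `νS := Measure.haar` and the product split `cq hcq` by Haar uniqueness.
Every other binder and the conclusion are those of `tailForArch_seesaw_of_ratio_compact`, token for token.
THE RESIDUAL (the (7b) census at this layer): `ht` · the Haar measures `νinf νinf' νA νA'` · the level prime `p hp hγ₀`
with (E1)'s `hns` · the print `hZc` · the sign data `hw hcm hα hβ hdef` · the K-type matching `hchi hchi'` · `haway` (∀-form).

Nothing here says anything about the status of the Hodge conjecture for CM abelian varieties, which is NOT proved
(HC_CM is NOT proved by anyone in this repository).
-/

set_option autoImplicit false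

noncomputable section

namespace Summit.Ventures.HodgeRepro.Tier4.Line4

open Matrix MeasureTheory Topology Filter NumberField IsDedekindDomain Summit.Ventures.HodgeRepro.Tier4
  Summit.Ventures.HodgeRepro.Tier4.Common Summit.Ventures.HodgeRepro.Tier4.Line1
  Summit.Ventures.HodgeRepro.Tier4.Line1.RTF Summit.Ventures.HodgeRepro.Tier4.Line4.L1Class

open scoped NumberField NNReal ENNReal Pointwise Matrix ComplexConjugate

section Domain

variable {k : Type} [Field k] [NumberField k]

/-- **The (7b) display body at the plane of record with the product `Z(k)`-domain drawn inside**: from (E1)'s `hns`,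
ZDOMAIN-EX's `hZc` and (S-FIN-NV)'s display at every `centreAway`-fundamental domain. -/
theorem tailForArch_seesaw_of_ratio_domain (q : QuadData k) (ht : q.t = 0) (hn : ¬ IsSquare (-q.n))
    (a : Fin 4 → k) (ha : ∀ i, a i ≠ 0)
    (g g' : Matrix (Fin 4) (Fin 4) k) (hgg' : g * g' = 1) (hg'g : g' * g = 1)
    (hgΩ : g * (PlaneData.mixedRow q (a 0) (a 2)).Ω = (PlaneData.mixedRow q (a 0) (a 2)).Ω * g)
    (lam : k) (hlam : lam ≠ 0)
    (hiso : g * (PlaneData.mixedRow q (a 1) (a 3)).B * gᵀ = lam • (PlaneData.mixedRow q (a 0) (a 2)).B)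
    [MeasurableSpace (GA ((PlaneData.mixedRow q (a 0) (a 2)).withTransportedTorus g g' hgg' hg'g hgΩ))] [BorelSpace (GA ((PlaneData.mixedRow q (a 0) (a 2)).withTransportedTorus g g' hgg' hg'g hgΩ))]
    (R : RTFData ((PlaneData.mixedRow q (a 0) (a 2)).withTransportedTorus g g' hgg' hg'g hgΩ)) (hRH : R.IsHaar)
    (hc : Continuous R.chi) (hu : ∀ a, ‖R.chi a‖ = 1) (hc' : Continuous R.chi') (hu' : ∀ a, ‖R.chi' a‖ = 1)
    (w₀ : InfinitePlace k) (eP eM eP' eM' : InfinitePlace k → ℤ)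
    -- the K-type matching of the display (its own `_hchi` / `_hchi'`), in `D : KTypeData`'s place
    (hchi : ∀ w, ChiMatchesAt ((PlaneData.mixedRow q (a 0) (a 2)).withTransportedTorus g g' hgg' hg'g hgΩ) q w (eP w) (eM w) R.chi)
    (hchi' : ∀ w, ChiMatchesAt' ((PlaneData.mixedRow q (a 0) (a 2)).withTransportedTorus g g' hgg' hg'g hgΩ) q w g g' (eP' w) (eM' w) R.chi')
    [R.μT.IsHaarMeasure] [R.μT'.IsHaarMeasure]
    (μ : Measure (GA ((PlaneData.mixedRow q (a 0) (a 2)).withTransportedTorus g g' hgg' hg'g hgΩ))) [μ.IsHaarMeasure] (DG : Set (GA ((PlaneData.mixedRow q (a 0) (a 2)).withTransportedTorus g g' hgg' hg'g hgΩ))) (fdG : IsFundamentalDomain (rationalPoints ((PlaneData.mixedRow q (a 0) (a 2)).withTransportedTorus g g' hgg' hg'g hgΩ)) DG μ)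
    (compG : IsCompact (closure DG)) (compT : IsCompact (closure R.DT)) (compT' : IsCompact (closure R.DT'))
    (γ₀ : rationalPoints ((PlaneData.mixedRow q (a 0) (a 2)).withTransportedTorus g g' hgg' hg'g hgΩ)) (hlin : IsLinRegular ((PlaneData.mixedRow q (a 0) (a 2)).withTransportedTorus g g' hgg' hg'g hgΩ) γ₀)
    (νinf : Measure (torusInf ((PlaneData.mixedRow q (a 0) (a 2)).withTransportedTorus g g' hgg' hg'g hgΩ))) [νinf.IsHaarMeasure]
    (νinf' : Measure (torusInf' ((PlaneData.mixedRow q (a 0) (a 2)).withTransportedTorus g g' hgg' hg'g hgΩ))) [νinf'.IsHaarMeasure]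
    (p : ℕ) (hp : p.Prime)
    (hγ₀ : ∀ v : HeightOneSpectrum (𝓞 k), natSize k v p < 1 → ∀ i j : Fin 4,
      Valued.v (finPart k (GA.mat ((PlaneData.mixedRow q (a 0) (a 2)).withTransportedTorus g g' hgg' hg'g hgΩ) (γ₀ : GA ((PlaneData.mixedRow q (a 0) (a 2)).withTransportedTorus g g' hgg' hg'g hgΩ)) i j) v) ≤ 1 ∧ Valued.v (finPart k (GA.mat ((PlaneData.mixedRow q (a 0) (a 2)).withTransportedTorus g g' hgg' hg'g hgΩ) (γ₀ : GA ((PlaneData.mixedRow q (a 0) (a 2)).withTransportedTorus g g' hgg' hg'g hgΩ))⁻¹ i j) v) ≤ 1)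
    -- (E1)'s local clause at `p` and ZDOMAIN-EX's cocompactness of `Z(k)` in `Z_f` (AwayDomainRowNonsplit's displayed inputs)
    (hns : ∀ v ∈ placesAbove (k := k) p, ¬ IsSquare (algebraMap k (v.adicCompletion k) (q.t ^ 2 - 4 * q.n)))
    (hZc : ∃ E : Set (torusFin ((PlaneData.mixedRow q (a 0) (a 2)).withTransportedTorus g g' hgg' hg'g hgΩ)), IsCompact E ∧
      E ⊆ (ZfIn ((PlaneData.mixedRow q (a 0) (a 2)).withTransportedTorus g g' hgg' hg'g hgΩ) : Set _) ∧
      (ZfIn ((PlaneData.mixedRow q (a 0) (a 2)).withTransportedTorus g g' hgg' hg'g hgΩ) : Set _) ⊆ (centreFin ((PlaneData.mixedRow q (a 0) (a 2)).withTransportedTorus g g' hgg' hg'g hgΩ) : Set _) * E)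
    -- the away Haar measures (the product `Z(k)`-domain of record is drawn inside from `hns`, `hZc` and the CM clauses)
    (νA : Measure (torusFinAway ((PlaneData.mixedRow q (a 0) (a 2)).withTransportedTorus g g' hgg' hg'g hgΩ) (placesAbove (k := k) p))) [νA.IsHaarMeasure]
    (νA' : Measure (torusFinAway' ((PlaneData.mixedRow q (a 0) (a 2)).withTransportedTorus g g' hgg' hg'g hgΩ) (placesAbove (k := k) p))) [νA'.IsHaarMeasure]
    -- (S-FIN-NV)'s display at EVERY `centreAway`-fundamental domain (the domain is DRAWN inside: AwayDomainRowNonsplit)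
    (haway : ∀ DA : Set (torusFinAway ((PlaneData.mixedRow q (a 0) (a 2)).withTransportedTorus g g' hgg' hg'g hgΩ) (placesAbove (k := k) p)), MeasurableSet DA →
      IsFundamentalDomain (centreAway ((PlaneData.mixedRow q (a 0) (a 2)).withTransportedTorus g g' hgg' hg'g hgΩ) (placesAbove (k := k) p)) DA νA →
      awayOrbital ((PlaneData.mixedRow q (a 0) (a 2)).withTransportedTorus g g' hgg' hg'g hgΩ) (placesAbove (k := k) p) R (γ₀ : GA ((PlaneData.mixedRow q (a 0) (a 2)).withTransportedTorus g g' hgg' hg'g hgΩ)) νA νA' DA ≠ 0)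
    -- (S-COUNT) BY NAME: the sign data of display (8) in `hcount`'s place — `w₀` (already bound: the indefinite place of
    -- `IsArchCoeffD`) real and CM, the `(1,1)` signs `hα hβ` at `w₀`, and the ONE displayed definiteness clause `hdef`
    (hw : w₀.IsReal) (hcm : IsCMAt q w₀) (hα : 0 < alphaLoc (a 0) hw) (hβ : betaLoc (a 2) (-1) hw < 0)
    (hdef : SeesawDefinite q a w₀) :
    ∀ finf : GA ((PlaneData.mixedRow q (a 0) (a 2)).withTransportedTorus g g' hgg' hg'g hgΩ) → ℂ,
      IsArchCoeffD ((PlaneData.mixedRow q (a 0) (a 2)).withTransportedTorus g g' hgg' hg'g hgΩ) (Setting.ofAdelicData ((PlaneData.mixedRow q (a 0) (a 2)).withTransportedTorus g g' hgg' hg'g hgΩ) R μ DG fdG compG compT compT') R q g g' w₀ eP eM eP' eM'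
        (γ₀ : GA ((PlaneData.mixedRow q (a 0) (a 2)).withTransportedTorus g g' hgg' hg'g hgΩ)) νinf νinf' finf →
      ∃ lev : ℕ → ℕ, (∀ n, lev n ≠ 0) ∧
      ∃ ffin f₂ : ℕ → GA ((PlaneData.mixedRow q (a 0) (a 2)).withTransportedTorus g g' hgg' hg'g hgΩ) → ℂ, TailFamily' ((PlaneData.mixedRow q (a 0) (a 2)).withTransportedTorus g g' hgg' hg'g hgΩ) q g g' eP' eM' (γ₀ : GA ((PlaneData.mixedRow q (a 0) (a 2)).withTransportedTorus g g' hgg' hg'g hgΩ)) ffin f₂ ∧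
        ∃ E : Finset (Setting.ofAdelicData ((PlaneData.mixedRow q (a 0) (a 2)).withTransportedTorus g g' hgg' hg'g hgΩ) R μ DG fdG compG compT compT').Orbit,
          (Setting.ofAdelicData ((PlaneData.mixedRow q (a 0) (a 2)).withTransportedTorus g g' hgg' hg'g hgΩ) R μ DG fdG compG compT compT').orbitOf γ₀ ∈ E ∧
          FibreDominatedFrom (Setting.ofAdelicData ((PlaneData.mixedRow q (a 0) (a 2)).withTransportedTorus g g' hgg' hg'g hgΩ) R μ DG fdG compG compT compT') R.chi R.chi' E
            (fun n => (Setting.ofAdelicData ((PlaneData.mixedRow q (a 0) (a 2)).withTransportedTorus g g' hgg' hg'g hgΩ) R μ DG fdG compG compT compT').conv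
              (prodFn ((PlaneData.mixedRow q (a 0) (a 2)).withTransportedTorus g g' hgg' hg'g hgΩ) finf (ffin (lev n))) (f₂ (lev n))) := by
  -- every infinite place of `k` is real and CM
  have hreal : ∀ w : InfinitePlace k, w.IsReal := fun w => by
    by_cases h : w = w₀
    · exact h ▸ hw
    · exact (hdef w h).1
  have hcmAll : ∀ w : InfinitePlace k, IsCMAt q w := fun w => by
    by_cases h : w = w₀
    · exact h ▸ hcm
    · exact (hdef w h).2.1
  -- the finite Haar measure `νf := Measure.haar` on `T_f` and the product Haar split at `placesAbove p` (Haar uniqueness,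
  -- `νS := Measure.haar`)
  haveI := locallyCompact_torusFin ((PlaneData.mixedRow q (a 0) (a 2)).withTransportedTorus g g' hgg' hg'g hgΩ)
  haveI : BorelSpace (torusFin ((PlaneData.mixedRow q (a 0) (a 2)).withTransportedTorus g g' hgg' hg'g hgΩ)) := Subtype.borelSpace _
  haveI := locallyCompact_torusFinAt ((PlaneData.mixedRow q (a 0) (a 2)).withTransportedTorus g g' hgg' hg'g hgΩ) (placesAbove (k := k) p)
  haveI : BorelSpace (torusFinAt ((PlaneData.mixedRow q (a 0) (a 2)).withTransportedTorus g g' hgg' hg'g hgΩ) (placesAbove (k := k) p)) := Subtype.borelSpace _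
  haveI : BorelSpace (torusT ((PlaneData.mixedRow q (a 0) (a 2)).withTransportedTorus g g' hgg' hg'g hgΩ)) := Subtype.borelSpace _
  obtain ⟨cq, -, hcq⟩ := exists_smul_map_prod_eq_fin ((PlaneData.mixedRow q (a 0) (a 2)).withTransportedTorus g g' hgg' hg'g hgΩ) (placesAbove (k := k) p) (Measure.haar : Measure (torusFin ((PlaneData.mixedRow q (a 0) (a 2)).withTransportedTorus g g' hgg' hg'g hgΩ)))
    (Measure.haar : Measure (torusFinAt ((PlaneData.mixedRow q (a 0) (a 2)).withTransportedTorus g g' hgg' hg'g hgΩ) (placesAbove (k := k) p))) νA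
  -- the product `Z(k)`-domain of record, drawn (AwayDomainRowNonsplit)
  obtain ⟨DA, hDA, hfdA, -, hfd, hDZc⟩ := exists_isFundamentalDomain_prod_univ_withTransportedTorus_of_nonsplit q (a 0) (a 2)
    g g' hgg' hg'g hgΩ (ha 0) (ha 2) ht hn hreal hcmAll hp hns _ _ νA cq hcq hZc
  exact tailForArch_seesaw_of_ratio_compact q ht hn a ha g g' hgg' hg'g hgΩ lam hlam hiso R hRH hc hu hc' hu' w₀ eP eM eP'
    eM' hchi hchi' μ DG fdG compG compT compT' γ₀ hlin νinf _ νinf' p hp hγ₀ νA νA' DA hDA hfd hDZc (haway DA hDA hfdA) hw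
    hcm hα hβ hdef


/-- **The same with (S-FIN-NV)'s display at ONE fundamental domain of the display's choice**: `haway` at an arbitrary
`centreAway`-fundamental domain `DA₀` (the display's text, unchanged) transfers to the drawn product domain by
`awayOrbital_ne_zero_forall_of_ne_zero` (AwayOrbitalDomain).  THE RESIDUAL: as `_domain`, with `haway` (∀-form) replaced by
`DA₀ hfd₀ haway` (one domain). -/
theorem tailForArch_seesaw_of_ratio_domain' (q : QuadData k) (ht : q.t = 0) (hn : ¬ IsSquare (-q.n))
    (a : Fin 4 → k) (ha : ∀ i, a i ≠ 0)
    (g g' : Matrix (Fin 4) (Fin 4) k) (hgg' : g * g' = 1) (hg'g : g' * g = 1)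
    (hgΩ : g * (PlaneData.mixedRow q (a 0) (a 2)).Ω = (PlaneData.mixedRow q (a 0) (a 2)).Ω * g)
    (lam : k) (hlam : lam ≠ 0)
    (hiso : g * (PlaneData.mixedRow q (a 1) (a 3)).B * gᵀ = lam • (PlaneData.mixedRow q (a 0) (a 2)).B)
    [MeasurableSpace (GA ((PlaneData.mixedRow q (a 0) (a 2)).withTransportedTorus g g' hgg' hg'g hgΩ))] [BorelSpace (GA ((PlaneData.mixedRow q (a 0) (a 2)).withTransportedTorus g g' hgg' hg'g hgΩ))]
    (R : RTFData ((PlaneData.mixedRow q (a 0) (a 2)).withTransportedTorus g g' hgg' hg'g hgΩ)) (hRH : R.IsHaar)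
    (hc : Continuous R.chi) (hu : ∀ a, ‖R.chi a‖ = 1) (hc' : Continuous R.chi') (hu' : ∀ a, ‖R.chi' a‖ = 1)
    (w₀ : InfinitePlace k) (eP eM eP' eM' : InfinitePlace k → ℤ)
    -- the K-type matching of the display (its own `_hchi` / `_hchi'`), in `D : KTypeData`'s place
    (hchi : ∀ w, ChiMatchesAt ((PlaneData.mixedRow q (a 0) (a 2)).withTransportedTorus g g' hgg' hg'g hgΩ) q w (eP w) (eM w) R.chi)
    (hchi' : ∀ w, ChiMatchesAt' ((PlaneData.mixedRow q (a 0) (a 2)).withTransportedTorus g g' hgg' hg'g hgΩ) q w g g' (eP' w) (eM' w) R.chi')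
    [R.μT.IsHaarMeasure] [R.μT'.IsHaarMeasure]
    (μ : Measure (GA ((PlaneData.mixedRow q (a 0) (a 2)).withTransportedTorus g g' hgg' hg'g hgΩ))) [μ.IsHaarMeasure] (DG : Set (GA ((PlaneData.mixedRow q (a 0) (a 2)).withTransportedTorus g g' hgg' hg'g hgΩ))) (fdG : IsFundamentalDomain (rationalPoints ((PlaneData.mixedRow q (a 0) (a 2)).withTransportedTorus g g' hgg' hg'g hgΩ)) DG μ)
    (compG : IsCompact (closure DG)) (compT : IsCompact (closure R.DT)) (compT' : IsCompact (closure R.DT'))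
    (γ₀ : rationalPoints ((PlaneData.mixedRow q (a 0) (a 2)).withTransportedTorus g g' hgg' hg'g hgΩ)) (hlin : IsLinRegular ((PlaneData.mixedRow q (a 0) (a 2)).withTransportedTorus g g' hgg' hg'g hgΩ) γ₀)
    (νinf : Measure (torusInf ((PlaneData.mixedRow q (a 0) (a 2)).withTransportedTorus g g' hgg' hg'g hgΩ))) [νinf.IsHaarMeasure]
    (νinf' : Measure (torusInf' ((PlaneData.mixedRow q (a 0) (a 2)).withTransportedTorus g g' hgg' hg'g hgΩ))) [νinf'.IsHaarMeasure]
    (p : ℕ) (hp : p.Prime)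
    (hγ₀ : ∀ v : HeightOneSpectrum (𝓞 k), natSize k v p < 1 → ∀ i j : Fin 4,
      Valued.v (finPart k (GA.mat ((PlaneData.mixedRow q (a 0) (a 2)).withTransportedTorus g g' hgg' hg'g hgΩ) (γ₀ : GA ((PlaneData.mixedRow q (a 0) (a 2)).withTransportedTorus g g' hgg' hg'g hgΩ)) i j) v) ≤ 1 ∧ Valued.v (finPart k (GA.mat ((PlaneData.mixedRow q (a 0) (a 2)).withTransportedTorus g g' hgg' hg'g hgΩ) (γ₀ : GA ((PlaneData.mixedRow q (a 0) (a 2)).withTransportedTorus g g' hgg' hg'g hgΩ))⁻¹ i j) v) ≤ 1)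
    -- (E1)'s local clause at `p` and ZDOMAIN-EX's cocompactness of `Z(k)` in `Z_f` (AwayDomainRowNonsplit's displayed inputs)
    (hns : ∀ v ∈ placesAbove (k := k) p, ¬ IsSquare (algebraMap k (v.adicCompletion k) (q.t ^ 2 - 4 * q.n)))
    (hZc : ∃ E : Set (torusFin ((PlaneData.mixedRow q (a 0) (a 2)).withTransportedTorus g g' hgg' hg'g hgΩ)), IsCompact E ∧
      E ⊆ (ZfIn ((PlaneData.mixedRow q (a 0) (a 2)).withTransportedTorus g g' hgg' hg'g hgΩ) : Set _) ∧
      (ZfIn ((PlaneData.mixedRow q (a 0) (a 2)).withTransportedTorus g g' hgg' hg'g hgΩ) : Set _) ⊆ (centreFin ((PlaneData.mixedRow q (a 0) (a 2)).withTransportedTorus g g' hgg' hg'g hgΩ) : Set _) * E)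
    -- the away Haar measures (the product `Z(k)`-domain of record is drawn inside from `hns`, `hZc` and the CM clauses)
    (νA : Measure (torusFinAway ((PlaneData.mixedRow q (a 0) (a 2)).withTransportedTorus g g' hgg' hg'g hgΩ) (placesAbove (k := k) p))) [νA.IsHaarMeasure]
    (νA' : Measure (torusFinAway' ((PlaneData.mixedRow q (a 0) (a 2)).withTransportedTorus g g' hgg' hg'g hgΩ) (placesAbove (k := k) p))) [νA'.IsHaarMeasure]
    -- (S-FIN-NV)'s display at ONE `centreAway`-fundamental domain `DA₀` of the display's choice (the product domain of
    -- record is DRAWN inside: AwayDomainRowNonsplit; `haway` transfers to it by AwayOrbitalDomain)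
    (DA₀ : Set (torusFinAway ((PlaneData.mixedRow q (a 0) (a 2)).withTransportedTorus g g' hgg' hg'g hgΩ) (placesAbove (k := k) p)))
    (hfd₀ : IsFundamentalDomain (centreAway ((PlaneData.mixedRow q (a 0) (a 2)).withTransportedTorus g g' hgg' hg'g hgΩ) (placesAbove (k := k) p)) DA₀ νA)
    (haway : awayOrbital ((PlaneData.mixedRow q (a 0) (a 2)).withTransportedTorus g g' hgg' hg'g hgΩ) (placesAbove (k := k) p) R (γ₀ : GA ((PlaneData.mixedRow q (a 0) (a 2)).withTransportedTorus g g' hgg' hg'g hgΩ)) νA νA' DA₀ ≠ 0)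
    -- (S-COUNT) BY NAME: the sign data of display (8) in `hcount`'s place — `w₀` (already bound: the indefinite place of
    -- `IsArchCoeffD`) real and CM, the `(1,1)` signs `hα hβ` at `w₀`, and the ONE displayed definiteness clause `hdef`
    (hw : w₀.IsReal) (hcm : IsCMAt q w₀) (hα : 0 < alphaLoc (a 0) hw) (hβ : betaLoc (a 2) (-1) hw < 0)
    (hdef : SeesawDefinite q a w₀) :
    ∀ finf : GA ((PlaneData.mixedRow q (a 0) (a 2)).withTransportedTorus g g' hgg' hg'g hgΩ) → ℂ,
      IsArchCoeffD ((PlaneData.mixedRow q (a 0) (a 2)).withTransportedTorus g g' hgg' hg'g hgΩ) (Setting.ofAdelicData ((PlaneData.mixedRow q (a 0) (a 2)).withTransportedTorus g g' hgg' hg'g hgΩ) R μ DG fdG compG compT compT') R q g g' w₀ eP eM eP' eM'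
        (γ₀ : GA ((PlaneData.mixedRow q (a 0) (a 2)).withTransportedTorus g g' hgg' hg'g hgΩ)) νinf νinf' finf →
      ∃ lev : ℕ → ℕ, (∀ n, lev n ≠ 0) ∧
      ∃ ffin f₂ : ℕ → GA ((PlaneData.mixedRow q (a 0) (a 2)).withTransportedTorus g g' hgg' hg'g hgΩ) → ℂ, TailFamily' ((PlaneData.mixedRow q (a 0) (a 2)).withTransportedTorus g g' hgg' hg'g hgΩ) q g g' eP' eM' (γ₀ : GA ((PlaneData.mixedRow q (a 0) (a 2)).withTransportedTorus g g' hgg' hg'g hgΩ)) ffin f₂ ∧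
        ∃ E : Finset (Setting.ofAdelicData ((PlaneData.mixedRow q (a 0) (a 2)).withTransportedTorus g g' hgg' hg'g hgΩ) R μ DG fdG compG compT compT').Orbit,
          (Setting.ofAdelicData ((PlaneData.mixedRow q (a 0) (a 2)).withTransportedTorus g g' hgg' hg'g hgΩ) R μ DG fdG compG compT compT').orbitOf γ₀ ∈ E ∧
          FibreDominatedFrom (Setting.ofAdelicData ((PlaneData.mixedRow q (a 0) (a 2)).withTransportedTorus g g' hgg' hg'g hgΩ) R μ DG fdG compG compT compT') R.chi R.chi' E
            (fun n => (Setting.ofAdelicData ((PlaneData.mixedRow q (a 0) (a 2)).withTransportedTorus g g' hgg' hg'g hgΩ) R μ DG fdG compG compT compT').conv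
              (prodFn ((PlaneData.mixedRow q (a 0) (a 2)).withTransportedTorus g g' hgg' hg'g hgΩ) finf (ffin (lev n))) (f₂ (lev n))) := by
  -- every infinite place of `k` is real and CM
  have hreal : ∀ w : InfinitePlace k, w.IsReal := fun w => by
    by_cases h : w = w₀
    · exact h ▸ hw
    · exact (hdef w h).1
  have hcmAll : ∀ w : InfinitePlace k, IsCMAt q w := fun w => by
    by_cases h : w = w₀
    · exact h ▸ hcm
    · exact (hdef w h).2.1
  -- the finite Haar measure `νf := Measure.haar` on `T_f` and the product Haar split at `placesAbove p` (Haar uniqueness,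
  -- `νS := Measure.haar`)
  haveI := locallyCompact_torusFin ((PlaneData.mixedRow q (a 0) (a 2)).withTransportedTorus g g' hgg' hg'g hgΩ)
  haveI : BorelSpace (torusFin ((PlaneData.mixedRow q (a 0) (a 2)).withTransportedTorus g g' hgg' hg'g hgΩ)) := Subtype.borelSpace _
  haveI := locallyCompact_torusFinAt ((PlaneData.mixedRow q (a 0) (a 2)).withTransportedTorus g g' hgg' hg'g hgΩ) (placesAbove (k := k) p)
  haveI : BorelSpace (torusFinAt ((PlaneData.mixedRow q (a 0) (a 2)).withTransportedTorus g g' hgg' hg'g hgΩ) (placesAbove (k := k) p)) := Subtype.borelSpace _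
  haveI : BorelSpace (torusT ((PlaneData.mixedRow q (a 0) (a 2)).withTransportedTorus g g' hgg' hg'g hgΩ)) := Subtype.borelSpace _
  obtain ⟨cq, -, hcq⟩ := exists_smul_map_prod_eq_fin ((PlaneData.mixedRow q (a 0) (a 2)).withTransportedTorus g g' hgg' hg'g hgΩ) (placesAbove (k := k) p) (Measure.haar : Measure (torusFin ((PlaneData.mixedRow q (a 0) (a 2)).withTransportedTorus g g' hgg' hg'g hgΩ)))
    (Measure.haar : Measure (torusFinAt ((PlaneData.mixedRow q (a 0) (a 2)).withTransportedTorus g g' hgg' hg'g hgΩ) (placesAbove (k := k) p))) νA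
  -- the product `Z(k)`-domain of record, drawn (AwayDomainRowNonsplit)
  obtain ⟨DA, hDA, hfdA, -, hfd, hDZc⟩ := exists_isFundamentalDomain_prod_univ_withTransportedTorus_of_nonsplit q (a 0) (a 2)
    g g' hgg' hg'g hgΩ (ha 0) (ha 2) ht hn hreal hcmAll hp hns _ _ νA cq hcq hZc
  exact tailForArch_seesaw_of_ratio_compact q ht hn a ha g g' hgg' hg'g hgΩ lam hlam hiso R hRH hc hu hc' hu' w₀ eP eM eP'
    eM' hchi hchi' μ DG fdG compG compT compT' γ₀ hlin νinf _ νinf' p hp hγ₀ νA νA' DA hDA hfd hDZc 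
    (awayOrbital_ne_zero_forall_of_ne_zero _ _ R (γ₀ : GA ((PlaneData.mixedRow q (a 0) (a 2)).withTransportedTorus g g' hgg' hg'g hgΩ)) hu νA νA' hfd₀ haway DA hDA hfdA) hw
    hcm hα hβ hdef


end Domain

end Summit.Ventures.HodgeRepro.Tier4.Line4

end
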